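import Literature.AlgebraicGeometry.Resolution.ArithmeticalThreefoldsDescentComposite
import Literature.AlgebraicGeometry.Resolution.RegularHomRegularLocus
import Literature.AlgebraicGeometry.Resolution.ExcellentRingsFieldProofs
import Literature.AlgebraicGeometry.Resolution.ExcellentRingsEssFiniteType
import Literature.AlgebraicGeometry.Resolution.RegularLocalRingsProofs
import Mathlib.RingTheory.Ideal.MinimalPrime.Localization
import HarnessLib

/-!
# Cossart–Piltant 2019, Prop. 4.8: the formal branch `Â/P̂₁` is regular at the prime `P∞` of
# `K`-infinitesimal elements

Topic: `Literature/AlgebraicGeometry/Resolution` (proofs only; no new notions, no new named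
facts). In the proof of Prop. 4.8 of Cossart–Piltant (J. Algebra 529 (2019) =
arXiv:1412.0868; arXiv v1 Prop. 4.6, pp. 52–53) the model `Ŷ → Spec Â` is "an isomorphism above
`Spec Â_g`, `0 ≠ g ∈ 𝔪_A` with `Spec A_g` regular" — the formal branch is already regular where
the descent needs no modification. For the composite route of
`ArithmeticalThreefoldsDescentComposite.lean` this is the hypothesis `hregP`: the image
`Ā = Â/P̂₁ ⊆ K̂₁` is regular at the centre `P∞` of the `K`-bounded coarsening `O₁` of `v̂`. We
PROVE it for every Noetherian local domain `A` essentially of finite type over a field: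

* `isRegularLocalRing_localization_centre_boundedBy` — `Ā_{P∞}` is a regular local ring.

Proof: `P∞ ∩ A = 0` (nonzero elements of `K` are units of `O₁`), so `Â_{P∞}` lies over the
generic point of `Spec A`; `A → Â` is a regular homomorphism (`A` is a G-ring, being essentially
of finite type over a field; `IsGRing.isRegularLocalRing_localization_adicCompletion_iff`,
Matsumura Thm. 23.7 / §32), and `A_{(0)} = K` is regular, so `Â_{P∞}` is regular; a regular
local ring is a domain, so the minimal prime `P̂₁ ⊆ P∞` dies in `Â_{P∞}`
(`IsLocalization.minimalPrimes_map`) and `Ā_{P∞} = Â_{P∞}/P̂₁Â_{P∞} = Â_{P∞}`, realised inside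
`K̂₁` as `locAtCentre Ā O₁`.

## Sources

* V. Cossart, O. Piltant, J. Algebra 529 (2019) 268–535 = arXiv:1412.0868, proof of Prop. 4.8
  (arXiv v1: Prop. 4.6, pp. 52–53). [CossartPiltant2019]
* H. Matsumura, *Commutative Ring Theory* (1986), Thm. 23.7, §32 p. 256, p. 260. [Matsumura1987]
-/

noncomputable section

namespace Literature.AlgebraicGeometry.Resolution

universe u

open IsLocalRing Function

section BoundedCentre

variable {A : Type u} [CommRing A] [IsDomain A] [IsLocalRing A] [IsNoetherianRing A]
  {K : Type u} [Field K] [Algebra A K] [IsFractionRing A K]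

/-- A localization of a domain at the zero ideal is a regular local ring (it is a field: its
maximal ideal is `(0)`). [folklore] -/
private theorem isRegularLocalRing_localization_atPrime_of_eq_bot {R : Type u} [CommRing R]
    [IsDomain R] [IsNoetherianRing R] (p : Ideal R) [p.IsPrime] (hp : p = ⊥) :
    IsRegularLocalRing (Localization.AtPrime p) := by
  subst hp
  haveI : IsNoetherianRing (Localization.AtPrime (⊥ : Ideal R)) :=
    IsLocalization.isNoetherianRing (⊥ : Ideal R).primeCompl _ inferInstance
  apply IsRegularLocalRing.of_spanFinrank_maximalIdeal_le
  have hm : maximalIdeal (Localization.AtPrime (⊥ : Ideal R)) = ⊥ := by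
    rw [← Localization.AtPrime.map_eq_maximalIdeal, Ideal.map_bot]
  rw [hm, Submodule.spanFinrank_bot]
  exact ringKrullDim_nonneg_of_nontrivial

set_option maxHeartbeats 800000 in
/-- **The formal branch is regular at `P∞`** ("`Ŷ → Spec Â` an isomorphism above `Spec Â_g`",
Cossart–Piltant 2019, proof of Prop. 4.8): let `A` be a Noetherian local domain essentially of
finite type over a field `k` with fraction field `K`, `K̂₁` a field under `Â` whose kernel `P̂₁`
is a minimal prime, `ι : K → K̂₁` compatible with `A → Â`, `O'` a valuation ring of `K̂₁` and
`O₁ ⊇ Ā := im(Â → K̂₁)` its `K`-bounded coarsening (`x ∈ O₁ ↔ v̂(x) ≥ v̂(ι b)` for some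
`b ∈ K^×`). Then the localization of `Ā` at the centre of `O₁` (the prime `P∞` of
`K`-infinitesimal elements) is a regular local ring. Proof: `P∞ ∩ A = 0`; `A → Â` is regular
(`A` is a G-ring) and `A_{(0)}` is a field, so `Â_{P∞}` is regular (Matsumura Thm. 23.7), hence
a domain, so `P̂₁ Â_{P∞} = 0` and `Ā_{P∞} ≅ Â_{P∞}`.
[cite: CossartPiltant2019, proof of Prop. 4.8 (arXiv v1: Prop. 4.6, pp. 52–53)]
[cite: Matsumura1987, Thm. 23.7 and §32 p. 256] -/
theorem isRegularLocalRing_localization_centre_boundedBy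
    (k : Type u) [Field k] [Algebra k A] [Algebra.EssFiniteType k A]
    {K₁ : Type u} [Field K₁] [Algebra (AdicCompletion (maximalIdeal A) A) K₁]
    (hP₁ : RingHom.ker (algebraMap (AdicCompletion (maximalIdeal A) A) K₁) ∈
      minimalPrimes (AdicCompletion (maximalIdeal A) A))
    (ι : K →+* K₁) (hι : ι.comp (algebraMap A K) =
      (algebraMap (AdicCompletion (maximalIdeal A) A) K₁).comp
        (algebraMap A (AdicCompletion (maximalIdeal A) A)))
    (O' O₁ : ValuationSubring K₁)
    (hO₁ : ∀ x : K₁, x ∈ O₁ ↔ ∃ b : K, b ≠ 0 ∧ O'.valuation x ≤ O'.valuation (ι b))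
    (hbotO₁ : (⊥ : Subalgebra (AdicCompletion (maximalIdeal A) A) K₁).toSubring ≤ O₁.toSubring) :
    IsRegularLocalRing
      (Localization.AtPrime ((maximalIdeal O₁).comap (Subring.inclusion hbotO₁))) := by
  classical
  set Ah := AdicCompletion (maximalIdeal A) A with hAhdef
  haveI : IsNoetherianRing Ah := isNoetherianRing_adicCompletion_maximalIdeal A
  set Abar : Subring K₁ := (⊥ : Subalgebra Ah K₁).toSubring with hAbardef
  set 𝔮 : Ideal Abar := (maximalIdeal O₁).comap (Subring.inclusion hbotO₁) with h𝔮def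
  have hιA : ∀ x : A, algebraMap Ah K₁ (algebraMap A Ah x) = ι (algebraMap A K x) := fun x => by
    have := RingHom.congr_fun hι x
    simpa only [RingHom.comp_apply] using this.symm
  have hmemAbar : ∀ a : Ah, algebraMap Ah K₁ a ∈ Abar := fun a => Algebra.mem_bot.mpr ⟨a, rfl⟩
  let πb : Ah →+* Abar := (algebraMap Ah K₁).codRestrict Abar hmemAbar
  have hπb : ∀ a : Ah, ((πb a : Abar) : K₁) = algebraMap Ah K₁ a := fun _ => rfl
  have hπbsurj : Function.Surjective πb := by
    rintro ⟨x, hx⟩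
    obtain ⟨a, rfl⟩ := Set.mem_range.mp (Algebra.mem_bot.mp hx)
    exact ⟨a, Subtype.ext rfl⟩
  -- membership in the centre `𝔮` of `O₁`
  have h𝔮 : ∀ x : Abar, x ∈ 𝔮 ↔ O₁.valuation (x : K₁) < 1 := fun x => by
    rw [h𝔮def, Ideal.mem_comap, ValuationSubring.valuation_lt_one_iff]; rfl
  have hval1 : ∀ x : Abar, x ∉ 𝔮 → O₁.valuation (x : K₁) = 1 := fun x hx => by
    rw [h𝔮] at hx
    exact le_antisymm ((O₁.valuation_le_one_iff _).mpr (hbotO₁ x.2)) (not_lt.mp hx)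
  -- the prime `𝔔 = P∞` of `Â`
  set 𝔔 : Ideal Ah := 𝔮.comap πb with h𝔔def
  haveI : 𝔔.IsPrime := Ideal.IsPrime.comap πb
  have h𝔔 : ∀ a : Ah, a ∈ 𝔔 ↔ O₁.valuation (algebraMap Ah K₁ a) < 1 := fun a => by
    rw [h𝔔def, Ideal.mem_comap, h𝔮]; rfl
  have hker𝔔 : RingHom.ker (algebraMap Ah K₁) ≤ 𝔔 := fun a ha => by
    rw [h𝔔, RingHom.mem_ker.mp ha, map_zero]; exact zero_lt_one
  -- `𝔔 ∩ A = 0`: nonzero elements of `K` are units of `O₁`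
  have hunder : 𝔔.under A = ⊥ := by
    refine le_bot_iff.mp fun x hx => ?_
    rw [Ideal.mem_bot]
    by_contra hx0
    have h1 : O₁.valuation (ι (algebraMap A K x)) = 1 :=
      valuation_boundedBy_map_eq_one O' O₁ ι hO₁
        ((map_ne_zero_iff _ (IsFractionRing.injective A K)).mpr hx0)
    have h2 : algebraMap A Ah x ∈ 𝔔 := hx
    rw [h𝔔, hιA, h1] at h2
    exact lt_irrefl _ h2
  -- `Â_𝔔` is regular: `A → Â` is a regular homomorphism and `A_{(0)}` is a field
  have hGA : IsGRing A :=
    ((isExcellentRing_of_field k).of_essFiniteType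
      (inferInstance : Algebra.EssFiniteType k A)).isQuasiExcellentRing.isGRing
  haveI h𝔔reg : IsRegularLocalRing (Localization.AtPrime 𝔔) :=
    (hGA.isRegularLocalRing_localization_adicCompletion_iff 𝔔).1.mpr
      (isRegularLocalRing_localization_atPrime_of_eq_bot (𝔔.under A) hunder)
  haveI : IsDomain (Localization.AtPrime 𝔔) := isDomain_of_isRegularLocalRing _
  -- the minimal prime `P̂₁ ⊆ 𝔔` dies in the domain `Â_𝔔`
  set L := Localization.AtPrime 𝔔 with hLdef
  have hPmap : (RingHom.ker (algebraMap Ah K₁)).map (algebraMap Ah L) = ⊥ := by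
    have hdisj : Disjoint (𝔔.primeCompl : Set Ah) (RingHom.ker (algebraMap Ah K₁)) := by
      rw [Set.disjoint_left]
      intro a ha hmem
      exact ha (hker𝔔 hmem)
    have hmin : (RingHom.ker (algebraMap Ah K₁)).map (algebraMap Ah L) ∈ minimalPrimes L := by
      have h1 : (RingHom.ker (algebraMap Ah K₁)).map (algebraMap Ah L) ∈
          ((⊥ : Ideal Ah).map (algebraMap Ah L)).minimalPrimes := by
        rw [IsLocalization.minimalPrimes_map 𝔔.primeCompl L ⊥, Set.mem_preimage,
          IsLocalization.under_map_of_isPrime_disjoint 𝔔.primeCompl L hP₁.1.1 hdisj]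
        exact hP₁
      rwa [Ideal.map_bot] at h1
    rw [IsDomain.minimalPrimes_eq_singleton_bot] at hmin
    exact hmin
  have hkerL : ∀ a : Ah, algebraMap Ah K₁ a = 0 → algebraMap Ah L a = 0 := fun a ha => by
    have : algebraMap Ah L a ∈ (RingHom.ker (algebraMap Ah K₁)).map (algebraMap Ah L) :=
      Ideal.mem_map_of_mem _ (RingHom.mem_ker.mpr ha)
    rw [hPmap] at this
    exact (Ideal.mem_bot.mp this)
  -- `Â_𝔔 → K̂₁`
  have hunits : ∀ s : 𝔔.primeCompl, IsUnit (algebraMap Ah K₁ s) := fun s => by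
    have hs : (s : Ah) ∉ 𝔔 := s.2
    rw [h𝔔] at hs
    refine isUnit_iff_ne_zero.mpr fun h0 => hs ?_
    rw [h0, map_zero]; exact zero_lt_one
  let f : L →+* K₁ := IsLocalization.lift (M := 𝔔.primeCompl) (S := L) hunits
  have hfmk : ∀ (a : Ah) (s : 𝔔.primeCompl),
      f (IsLocalization.mk' L a s) = algebraMap Ah K₁ a / algebraMap Ah K₁ s := fun a s => by
    rw [IsLocalization.lift_mk'_spec, mul_div_cancel₀ _ (hunits s).ne_zero]
  have hfinj : Function.Injective f := by
    rw [injective_iff_map_eq_zero]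
    intro x hx
    rw [← IsLocalization.mk'_sec (M := 𝔔.primeCompl) L x] at hx ⊢
    rw [hfmk, div_eq_zero_iff, or_iff_left (hunits _).ne_zero] at hx
    rw [IsLocalization.mk'_eq_mul_mk'_one, hkerL _ hx, zero_mul]
  -- the image of `f` is `Ā_𝔮 ⊆ K̂₁`
  have hrange : f.range = locAtCentre Abar O₁ := by
    ext y
    constructor
    · rintro ⟨x, rfl⟩
      rw [← IsLocalization.mk'_sec (M := 𝔔.primeCompl) L x, hfmk]
      have hsq : πb ((IsLocalization.sec 𝔔.primeCompl x).2 : Ah) ∉ 𝔮 :=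
        (IsLocalization.sec 𝔔.primeCompl x).2.2
      exact ⟨_, hmemAbar _, _, hmemAbar _, hval1 _ hsq, rfl⟩
    · rintro ⟨p, hp, q, hq, hvq, rfl⟩
      obtain ⟨a, rfl⟩ := Set.mem_range.mp (Algebra.mem_bot.mp hp)
      obtain ⟨s, rfl⟩ := Set.mem_range.mp (Algebra.mem_bot.mp hq)
      have hs : s ∈ 𝔔.primeCompl := by
        intro (hs : s ∈ 𝔔)
        rw [h𝔔, hvq] at hs
        exact lt_irrefl _ hs
      exact ⟨IsLocalization.mk' L a ⟨s, hs⟩, hfmk a ⟨s, hs⟩⟩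
  -- transfer regularity
  have hbij : Function.Bijective f.rangeRestrict :=
    ⟨fun x y hxy => hfinj (congrArg Subtype.val hxy), f.rangeRestrict_surjective⟩
  let e : L ≃+* locAtCentre Abar O₁ :=
    (RingEquiv.ofBijective f.rangeRestrict hbij).trans (RingEquiv.subringCongr hrange)
  have hreg : IsRegularLocalRing (locAtCentre Abar O₁) := IsRegularLocalRing.of_ringEquiv e
  exact (isRegularLocalRing_locAtCentre_iff hbotO₁).mp hreg

end BoundedCentre

end Literature.AlgebraicGeometry.Resolution

end
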